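import Summits.BirchSwinnertonDyer.BirchSwinnertonDyer.Theses.ThetaPartnerAtTwo
import HarnessLib

/-!
# Route `ThetaPartnerAtTwo` (rung W-ALL/1.hab): the join `Assembly`

The route's assembly item (stmt-BirchSwinnertonDyer-20311)
`Summit.BirchSwinnertonDyer.BirchSwinnertonDyer.Theses.ThetaPartnerAtTwo.Assembly :=
  ModularParametrizationSupply → EntireLFunctionRat → RankEqAnalyticRankLeOne →
    SignedTransportAtTwo → SignedMainConjectureCMTwo → SignedKatoDivisibilityUpToAtTwo →
    SignedControlAtTwo → OffThetaHabitatAtTwo →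
    Summit.BirchSwinnertonDyer.BirchSwinnertonDyer.Rank1Residual.NonCMAtTwo`
is the route's deciding chain read on the WHOLE of row 1 (`NonCMAtTwo`: non-CM, `r_an ≤ 1` ⇒
`BSD(E,2)`): ON the theta habitat (non-CM `W` of analytic rank `0`, good supersingular at `2`,
`a₂ = 0`, `2`-congruent to a rank-`0` CM good-supersingular partner `A` with `a₂(A) = 0`) the three
print supports give the partner's newform, period ratio and a Pollack pair at `2`
(`exists_isPollackPair_two`, needs `L(A,1) ≠ 0`), the CM signed main conjecture at `2` (item K2, here in
its full form `SignedMainConjectureCMTwo`, of which only the analytic-rank-`0` instance is used) feeds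
the signed Greenberg–Vatsal transport K1, and Kato's divisibility K3 + signed control K4 turn
Kobayashi's `+` main conjecture for `W` into `BSDp W 2` through the tree door
`bsdp_two_of_kobayashiMainConjecture_two_of_frobeniusTrace_eq_zero`; OFF the habitat the residual item
`OffThetaHabitatAtTwo` is the registered slice `WAllNonCMAtTwoOffThetaHabitat` verbatim, and the two
slices re-assemble row 1 by excluded middle (`Summit.BirchSwinnertonDyer.nonCMAtTwo_of_thetaHabitat_of_offThetaHabitat`).
Nothing is asserted here: the eight items stay hypotheses of `Assembly` itself. The habitat branch is
the body of the route's planner-authored deciding theorem `closes` (rev 19) INLINED rather than cited,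
so that later re-keyings of the binders of `closes` (PUB twins / aliases) do not touch this file.
BSD is not proved by this. [cite: Kobayashi2003, Thm 1.3] [cite: BDKim2013]
-/

set_option autoImplicit false
set_option linter.dupNamespace false

namespace Summit.BirchSwinnertonDyer.BirchSwinnertonDyer.Theorems

open Summit.BirchSwinnertonDyer.BirchSwinnertonDyer.Theses.ThetaPartnerAtTwo

/-- **The habitat branch of route `ThetaPartnerAtTwo`** (the chain of its deciding theorem, inlined):
the three print supports, signed transport K1, the CM signed main conjecture at `2` in analytic rank
`0` (K2r0), Kato's signed divisibility up to a `2`-power K3 and signed control K4 give the habitat leaf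
`WAllNonCMAtTwoThetaHabitat`. [cite: Kobayashi2003, Thm 1.3] -/
theorem wAllNonCMAtTwoThetaHabitat_of_thetaPartnerAtTwo_items (hmod : ModularParametrizationSupply)
    (hLrat : EntireLFunctionRat) (hGZK : RankEqAnalyticRankLeOne) (hT : SignedTransportAtTwo)
    (hCM : SignedMainConjectureCMTwoRankZero) (hKato : SignedKatoDivisibilityUpToAtTwo)
    (hStr : SignedControlAtTwo) : Summit.BirchSwinnertonDyer.WAllNonCMAtTwoThetaHabitat := by
  intro W _ _ hcm hr hss ha hH
  obtain ⟨A, iA, iA', hAcm, hAr, hAss, hAa, hcong⟩ := hH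
  have hL : W.entireLFunction 1 ≠ 0 := (W.analyticRank_eq_zero_iff_holds (hLrat W)).mp hr
  -- the CM partner's analytic data: newform, period ratio, a Pollack pair at 2 (needs L(A,1) ≠ 0)
  have hLA : A.entireLFunction 1 ≠ 0 := (A.analyticRank_eq_zero_iff_holds (hLrat A)).mp hAr
  haveI : NeZero (A.conductorNorm ℤ) := ⟨(A.conductorNorm_pos_holds).ne'⟩
  obtain ⟨DmA⟩ := hmod A
  obtain ⟨ϖA, hϖApos, hϖAeq, hΩApos⟩ := DmA.exists_rat_mul_realPeriodRat_eq_plusPeriod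
  obtain ⟨LsA, LfA, hSPA, hPPA⟩ :=
    Summit.BirchSwinnertonDyer.BirchSwinnertonDyer.Theorems.exists_isPollackPair_two DmA.isNewformOf hAss.1 hAa hLA
  -- K2r0: the CM partner's signed structure + main conjecture at 2, asked only at analytic rank 0
  obtain ⟨hmuA, hMCA⟩ := hCM A hAcm hAr hAss hAa
  have hMC : Summit.BirchSwinnertonDyer.Rank1Residual.Supersingular.KobayashiMainConjecture W 2 1 :=
    hT W A hcm hr hss ha hAcm hAss hAa hcong DmA.f DmA.isNewformOf ϖA hϖAeq LsA LfA hPPA hmuA hMCA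
      (hKato W hcm hr hss ha)
  obtain ⟨h12, hKim⟩ := hStr W hcm hr hss ha
  exact Summit.BirchSwinnertonDyer.BirchSwinnertonDyer.Theorems.bsdp_two_of_kobayashiMainConjecture_two_of_frobeniusTrace_eq_zero
    W hmod hGZK hss.1 ha hL h12 hKim hMC

/-- The full CM signed main conjecture at `2` (item K2, every CM good-supersingular `A` with
`a₂ = 0`) restricts to its analytic-rank-`0` instance K2r0. [folklore] -/
theorem signedMainConjectureCMTwoRankZero_of_signedMainConjectureCMTwo
    (hCM : SignedMainConjectureCMTwo) : SignedMainConjectureCMTwoRankZero :=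
  fun A _ _ hAcm _ hAss hAa => hCM A hAcm hAss hAa

/-- **The join of route `ThetaPartnerAtTwo` holds** (item stmt-BirchSwinnertonDyer-20311): the three
print supports, signed transport K1, the CM signed main conjecture at `2` K2, Kato's signed
divisibility K3, signed control K4 and the off-habitat residual give row 1 `NonCMAtTwo` — the habitat
branch by the route's deciding chain, the complement by the residual item, glued by excluded middle
on the habitat conjunction. [cite: Kobayashi2003, Thm 1.3] -/
theorem thetaPartnerAtTwo_assembly_proof :
    Summit.BirchSwinnertonDyer.BirchSwinnertonDyer.Theses.ThetaPartnerAtTwo.Assembly := by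
  unfold Summit.BirchSwinnertonDyer.BirchSwinnertonDyer.Theses.ThetaPartnerAtTwo.Assembly
  intro hmod hLrat hGZK hT hCM hKato hStr hOff
  exact Summit.BirchSwinnertonDyer.nonCMAtTwo_of_thetaHabitat_of_offThetaHabitat
    (wAllNonCMAtTwoThetaHabitat_of_thetaPartnerAtTwo_items hmod hLrat hGZK hT
      (signedMainConjectureCMTwoRankZero_of_signedMainConjectureCMTwo hCM) hKato hStr)
    (fun W _ _ hcm hr hH => hOff W hcm hr hH)

end Summit.BirchSwinnertonDyer.BirchSwinnertonDyer.Theorems
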